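import Literature.NumberTheory.LFunctions.Zhang2022.KnifeEdgeLenLongLegSplit
import HarnessLib

/-!
# 𝒳₂ `LongPairsGradedTables` (stmt-Parity-20446): the amplitude surcharge of Leg B and of the extended Lemma 8.1 is
# exactly linear too (refuter desk, negative lemmas; sequel of `LegSplitAmplitude.lean`)

Route `ZDegreeToeplitzBand`, crux 𝒳₂ = `LongPairsGradedTables` (HELD); typed first rung of the card `long-leg-split-chi-band`
= `Zhang2022/KnifeEdgeLenLongLegSplit.lean` (slots `KnifeEdge.LongLegSplit.FormulaILongPsi` (K2), `FormulaILongDual` (K1),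
`Lemma81LongPsi` (P2), `LegSplitTransferX2`; all OPEN, asserted by no one). `LegSplitAmplitude.lean` showed that K2 is
EQUIVALENT to its amplitude-`A` image with slack `ε·A·𝔓` (`formulaILongPsi_iff_amp`). Here the same for the other two
slots: the long datum sits in the k-side slot of Leg B (as `conj 𝐚₁`) and in both slots of P2's reflected term, and
`Theta1Ext`, `SjExt`, `mainMVExt`, `lhs81Ext` are linear — `EcalExt` absolutely homogeneous — in the k-side datum as well
(`Theta1Ext_const_mul_right`, `SjExt_const_mul_right`, `EcalExt_const_mul_right`, `mainMVExt_const_mul_right`,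
`lhs81Ext_const_mul_left`), so `formulaILongDual_iff_amp` and `lemma81LongPsi_iff_amp`: K1 and P2 carry EXACTLY
amplitude-linear information. Consequence for the referee's LSR-541 finding (M-RULEBOOK (D5′)(c), theory fold #11): for
the 𝒳₂ cell's datum `a₁ = D·(δ_D ⋆ υ1_{≤D⁴} ⋆ χg ⋆ χf)` (`A = D`) behind `−χ(p)/τ(χ)`, `|τ(χ)|⁻¹ = D^{−1/2}`
(`KnifeEdge.norm_inv_tau_eq`), EVERY black-box use of the three slots as typed leaves `ε·√D·𝔓` on `conj τ₂` against
`TauTwoTablePsi`'s `ε′·𝔞·𝔓` — the D^{1/2} shortfall of `LegSplitTransferX2` is slot-independent; it closes only with a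
re-typed slack (repair (a): `ε·𝒩(𝐚₁)·𝒩′(𝐚₂)·𝔓` with the ℓ²(dm/m)-type norms (7.5)/(7.15) consume, which regain
`D^{−1/2}` on data supported on the multiples of `D`). Route-independent (no `Theses` import: the slots are Literature `Prop`s; the four left-homogeneity helpers of
`LegSplitAmplitude.lean` are re-proved privately). Nothing here is false; no definition is declared; standard axioms.
«The programme SEARCHES and TYPES; no claim about Landau–Siegel zeros, Theorems 1–2 of arXiv:2211.02515 or a repaired
Margin232 until a kernel theorem says so.»

## References

* [Zhang2022LandauSiegel] Y. Zhang, Discrete mean estimates and the Landau–Siegel zero, arXiv:2211.02515v1 (2022):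
  §7 Prop. 7.1, (7.2), (7.5), (7.7)–(7.9), (7.15); §8 Lemma 8.1 (8.5), (8.8); §2 (2.5).
-/

noncomputable section

namespace Summit.Parity.GeneralizedHardyLittlewood.Theorems.LongPairsGradedTables.Negative

open Complex Real ComplexConjugate Finset
open Literature.NumberTheory.LFunctions.Zhang2022
open Literature.NumberTheory.LFunctions.Zhang2022.Skeleton
open Literature.NumberTheory.LFunctions.Zhang2022.Repair
open Literature.NumberTheory.LFunctions.Zhang2022.KnifeEdge
open Literature.NumberTheory.LFunctions.Zhang2022.KnifeEdge.LongLegSplit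

/-! ### The exact linear image for Leg B (`FormulaILongDual`) and P2 (`Lemma81LongPsi`)

The long datum sits in the k-side slot of Leg B (as `conj 𝐚₁`) and in both slots of P2's reflected term; `Theta1Ext`,
`SjExt`, `mainMVExt`, `lhs81Ext` are linear and `EcalExt` absolutely homogeneous in the k-side datum as well, so K1 and
P2 carry exactly amplitude-linear information too: each is EQUIVALENT to its amplitude-`A` image with slack `ε·A·𝔓`
(`formulaILongDual_iff_amp`, `lemma81LongPsi_iff_amp`). For the 𝒳₂ cell (`A = D` behind `|τ(χ)|⁻¹ = D^{−1/2}`) all three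
black boxes therefore leave `ε·√D·𝔓` on `conj τ₂`; the (D5′)(c) shortfall is slot-independent. -/

section HomogeneityRight

variable (c' : ℝ) {D : ℕ} (χ : DirichletCharacter ℂ D)

/-- (private copy of `dirPoly_const_mul`) `A(c·𝐚;s,ψ) = c·A(𝐚;s,ψ)`. [cite: Zhang2022LandauSiegel, §7 p. 13] -/
private theorem dirPoly_const_mul' {k : ℕ} (N : ℕ) (c : ℂ) (a : ℕ → ℂ) (ψ : DirichletCharacter ℂ k) (s : ℂ) :
    Lemma81.dirPoly N (fun n => c * a n) ψ s = c * Lemma81.dirPoly N a ψ s := by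
  simp only [Lemma81.dirPoly_def, Finset.mul_sum]
  exact Finset.sum_congr rfl fun n _ => by ring

/-- (private copy of `segInt_const_mul`) the segment integral is linear. [cite: Zhang2022LandauSiegel, §7 p. 13] -/
private theorem segInt_const_mul' (t₀ L₁ : ℝ) (z c : ℂ) (F : ℂ → ℂ) :
    Lemma81.segInt t₀ L₁ z (fun s => c * F s) = c * Lemma81.segInt t₀ L₁ z F := by
  simp only [Lemma81.segInt_def]
  rw [intervalIntegral.integral_const_mul]
  ring

/-- (private copy of `Theta1Ext_const_mul_left`) `Θ₁` is linear in `𝐚₁`. [cite: Zhang2022LandauSiegel, §7 Prop. 7.1] -/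
private theorem Theta1Ext_const_mul_left' (N₁ N₂ : ℕ) (c : ℂ) (a₁ a₂ : ℕ → ℂ) :
    Theta1Ext c' χ N₁ N₂ (fun n => c * a₁ n) a₂ = c * Theta1Ext c' χ N₁ N₂ a₁ a₂ := by
  unfold Theta1Ext
  rw [Finset.mul_sum]
  refine Finset.sum_congr rfl fun x _ => ?_
  rw [← segInt_const_mul']
  congr 1
  funext s
  rw [dirPoly_const_mul']
  ring

/-- (private copy of `longPsiData_const_mul_fun`) `𝐚₁` is linear in `b`. [cite: Zhang2022LandauSiegel, §8 (8.8)] -/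
private theorem longPsiData_const_mul_fun' (c : ℂ) (b : ℕ → ℂ) (g f : ℝ → ℂ) :
    longPsiData χ (fun m => c * b m) g f = fun n => c * longPsiData χ b g f n :=
  funext fun n => longPsiData_const_mul χ c b g f n

/-- `Θ₁` with extended truncations is linear in `𝐚₂`. [cite: Zhang2022LandauSiegel, §7 Prop. 7.1] -/
theorem Theta1Ext_const_mul_right (N₁ N₂ : ℕ) (c : ℂ) (a₁ a₂ : ℕ → ℂ) :
    Theta1Ext c' χ N₁ N₂ a₁ (fun n => c * a₂ n) = c * Theta1Ext c' χ N₁ N₂ a₁ a₂ := by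
  unfold Theta1Ext
  rw [Finset.mul_sum]
  refine Finset.sum_congr rfl fun x _ => ?_
  rw [← segInt_const_mul']
  congr 1
  funext s
  rw [dirPoly_const_mul']
  ring

/-- `S_j` with extended ranges is linear in `𝐚₂`. [cite: Zhang2022LandauSiegel, §7 Prop. 7.1] -/
theorem SjExt_const_mul_right (D N₁ N₂ j : ℕ) (c : ℂ) (a₁ a₂ : ℕ → ℂ) :
    SjExt c' D N₁ N₂ j a₁ (fun n => c * a₂ n) = c * SjExt c' D N₁ N₂ j a₁ a₂ := by
  unfold SjExt
  rw [Finset.mul_sum]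
  refine Finset.sum_congr rfl fun d _ => ?_
  rw [Finset.mul_sum]
  refine Finset.sum_congr rfl fun r _ => ?_
  have hn : (∑ n ∈ Finset.Ico 1 N₂, c * a₂ (d * r * n) * xiZero c' D j n d r / (n : ℂ))
      = c * ∑ n ∈ Finset.Ico 1 N₂, a₂ (d * r * n) * xiZero c' D j n d r / (n : ℂ) := by
    rw [Finset.mul_sum]
    exact Finset.sum_congr rfl fun n _ => by ring
  rw [hn]
  ring

/-- `E(𝐚₁,c·𝐚₂) = |c|·E(𝐚₁,𝐚₂)` (extended ranges). [cite: Zhang2022LandauSiegel, §7 Prop. 7.1] -/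
theorem EcalExt_const_mul_right (D N₁ N₂ : ℕ) (c : ℂ) (a₁ a₂ : ℕ → ℂ) :
    EcalExt c' D N₁ N₂ a₁ (fun n => c * a₂ n) = ‖c‖ * EcalExt c' D N₁ N₂ a₁ a₂ := by
  unfold EcalExt
  simp only [SjExt_const_mul_right, norm_mul]
  ring

/-- The main term with extended ranges is linear in `𝐚₂`. [cite: Zhang2022LandauSiegel, §7 Prop. 7.1] -/
theorem mainMVExt_const_mul_right (D N₁ N₂ : ℕ) (c : ℂ) (a₁ a₂ : ℕ → ℂ) :
    mainMVExt c' D N₁ N₂ a₁ (fun n => c * a₂ n) = c * mainMVExt c' D N₁ N₂ a₁ a₂ := by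
  unfold mainMVExt
  simp only [SjExt_const_mul_right]
  ring

/-- The conjugated long datum scales by the same REAL factor: `conj(𝐚₁(b/A)) = A⁻¹·conj(𝐚₁(b))`.
[cite: Zhang2022LandauSiegel, §8 (8.8)] -/
theorem conj_longPsiData_real_inv_mul_fun (A : ℝ) (b : ℕ → ℂ) (g f : ℝ → ℂ) :
    (fun n => conj (longPsiData χ (fun m => (A : ℂ)⁻¹ * b m) g f n))
      = fun n => (A : ℂ)⁻¹ * conj (longPsiData χ b g f n) := by
  funext n
  rw [longPsiData_const_mul, map_mul, map_inv₀, Complex.conj_ofReal]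

/-- The left side of Lemma 8.1 (extended truncations) is linear in `𝐚₁`. [cite: Zhang2022LandauSiegel, §8 Lemma 8.1 (8.5)] -/
theorem lhs81Ext_const_mul_left (N₁ N₂ : ℕ) (c : ℂ) (a₁ a₂ : ℕ → ℂ) :
    lhs81Ext c' χ N₁ N₂ (fun n => c * a₁ n) a₂ = c * lhs81Ext c' χ N₁ N₂ a₁ a₂ := by
  unfold lhs81Ext
  rw [Finset.mul_sum]
  refine Finset.sum_congr rfl fun i _ => ?_
  rw [dirPoly_const_mul']
  ring

end HomogeneityRight

/-- **`FormulaILongDual` at amplitude `A`: the exact linear image of Leg B** (long datum in the k-side slot).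
[cite: Zhang2022LandauSiegel, §7 Prop. 7.1, (7.7)–(7.9), (7.15)] -/
theorem formulaILongDual_amp {c' : ℝ} (h : FormulaILongDual c') :
    ∀ B : ℝ, ∀ ε : ℝ, 0 < ε → ∃ C : ℝ, ForAllLarge fun D _ χ => AssumptionA D χ →
      ∀ (A : ℝ), 0 < A → ∀ (b : ℕ → ℂ) (g g' f f' : ℝ → ℂ) (a₁ : ℕ → ℂ),
        InClassPiece g g' → InClassPiece f f' →
        (∀ x ∈ Set.Icc (0:ℝ) 1, ‖g x‖ ≤ 1) → (∀ x ∈ Set.Icc (0:ℝ) 1, ‖f x‖ ≤ 1) →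
        (∀ n, ‖b n‖ ≤ A * B * ((Nat.divisors n).card : ℝ) ^ 2) → (∀ n : ℕ, D ^ 5 < n → b n = 0) →
        Adm72 D B a₁ →
          ‖Theta1Ext c' χ (Nsupp D) (Nlong D) a₁ (fun n => conj (longPsiData χ b g f n))
              - mainMVExt c' D (Nsupp D) (Nlong D) a₁ (fun n => conj (longPsiData χ b g f n))‖
            ≤ C * EcalExt c' D (Nsupp D) (Nlong D) a₁ (fun n => conj (longPsiData χ b g f n))
              + ε * A * frakP D := by
  intro B ε hε
  obtain ⟨C, D₀, hD₀⟩ := h B ε hε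
  refine ⟨C, D₀, fun D _ χ hD hq hp hA A hApos b g g' f f' a₁ hg hf hg1 hf1 hb hb0 ha₁ => ?_⟩
  have hb'1 : ∀ n, ‖(A : ℂ)⁻¹ * b n‖ ≤ B * ((Nat.divisors n).card : ℝ) ^ 2 := by
    intro n
    rw [norm_mul, norm_inv, Complex.norm_real, Real.norm_eq_abs, abs_of_pos hApos, inv_mul_le_iff₀ hApos]
    calc ‖b n‖ ≤ A * B * ((Nat.divisors n).card : ℝ) ^ 2 := hb n
      _ = A * (B * ((Nat.divisors n).card : ℝ) ^ 2) := by ring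
  have hb'0 : ∀ n : ℕ, D ^ 5 < n → (A : ℂ)⁻¹ * b n = 0 := fun n hn => by rw [hb0 n hn, mul_zero]
  have key := hD₀ D χ hD hq hp hA (fun n => (A : ℂ)⁻¹ * b n) g g' f f' a₁ hg hf hg1 hf1 hb'1 hb'0 ha₁
  rw [conj_longPsiData_real_inv_mul_fun, Theta1Ext_const_mul_right, mainMVExt_const_mul_right,
    EcalExt_const_mul_right, ← mul_sub, norm_mul, norm_inv, Complex.norm_real, Real.norm_eq_abs,
    abs_of_pos hApos] at key
  have hmul := mul_le_mul_of_nonneg_left key hApos.le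
  rw [← mul_assoc, mul_inv_cancel₀ hApos.ne', one_mul] at hmul
  calc _ ≤ A * (C * (A⁻¹ * EcalExt c' D (Nsupp D) (Nlong D) a₁ (fun n => conj (longPsiData χ b g f n)))
        + ε * frakP D) := hmul
    _ = C * EcalExt c' D (Nsupp D) (Nlong D) a₁ (fun n => conj (longPsiData χ b g f n)) + ε * A * frakP D := by
        field_simp

/-- Leg B carries EXACTLY amplitude-linear information. [cite: Zhang2022LandauSiegel, §7 Prop. 7.1, (7.15)] -/
theorem formulaILongDual_iff_amp (c' : ℝ) :
    FormulaILongDual c' ↔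
    ∀ B : ℝ, ∀ ε : ℝ, 0 < ε → ∃ C : ℝ, ForAllLarge fun D _ χ => AssumptionA D χ →
      ∀ (A : ℝ), 0 < A → ∀ (b : ℕ → ℂ) (g g' f f' : ℝ → ℂ) (a₁ : ℕ → ℂ),
        InClassPiece g g' → InClassPiece f f' →
        (∀ x ∈ Set.Icc (0:ℝ) 1, ‖g x‖ ≤ 1) → (∀ x ∈ Set.Icc (0:ℝ) 1, ‖f x‖ ≤ 1) →
        (∀ n, ‖b n‖ ≤ A * B * ((Nat.divisors n).card : ℝ) ^ 2) → (∀ n : ℕ, D ^ 5 < n → b n = 0) →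
        Adm72 D B a₁ →
          ‖Theta1Ext c' χ (Nsupp D) (Nlong D) a₁ (fun n => conj (longPsiData χ b g f n))
              - mainMVExt c' D (Nsupp D) (Nlong D) a₁ (fun n => conj (longPsiData χ b g f n))‖
            ≤ C * EcalExt c' D (Nsupp D) (Nlong D) a₁ (fun n => conj (longPsiData χ b g f n))
              + ε * A * frakP D := by
  refine ⟨formulaILongDual_amp, fun h B ε hε => ?_⟩
  obtain ⟨C, D₀, hD₀⟩ := h B ε hε
  refine ⟨C, D₀, fun D _ χ hD hq hp hA b g g' f f' a₁ hg hf hg1 hf1 hb hb0 ha₁ => ?_⟩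
  have := hD₀ D χ hD hq hp hA 1 one_pos b g g' f f' a₁ hg hf hg1 hf1 (fun n => by rw [one_mul]; exact hb n) hb0 ha₁
  simpa only [mul_one, one_mul] using this

/-- **`Lemma81LongPsi` at amplitude `A`: the exact linear image of P2** (long datum in the ψ-slot of the direct term and,
conjugated, in the k-slot of the reflected term). [cite: Zhang2022LandauSiegel, §8 Lemma 8.1 (8.5), Lemma 3.3] -/
theorem lemma81LongPsi_amp {c' : ℝ} (h : Lemma81LongPsi c') :
    ∀ δ : ℝ, 0 < δ → ∀ B : ℝ, ∀ ε : ℝ, 0 < ε → ForAllLarge fun D _ χ => AssumptionA D χ →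
      ∀ (A : ℝ), 0 < A → ∀ (b : ℕ → ℂ) (g g' f f' : ℝ → ℂ) (a₂ : ℕ → ℂ) (θg θf : ℝ),
        ShortPiece θg g g' → ShortPiece θf f f' → θg + θf ≤ 2 - δ →
        (∀ x ∈ Set.Icc (0:ℝ) 1, ‖g x‖ ≤ 1) → (∀ x ∈ Set.Icc (0:ℝ) 1, ‖f x‖ ≤ 1) →
        (∀ n, ‖b n‖ ≤ A * B * ((Nat.divisors n).card : ℝ) ^ 2) → (∀ n : ℕ, D ^ 5 < n → b n = 0) →
        (∀ n, ‖a₂ n‖ ≤ B) → (∀ n : ℕ, D ^ 4 ≤ n → a₂ n = 0) →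
          ‖lhs81Ext c' χ (Nlong D) (Nsupp D) (longPsiData χ b g f) a₂ -
              (Theta1Ext c' χ (Nlong D) (Nsupp D) (longPsiData χ b g f) a₂ +
                conj (Theta1Ext c' χ (Nsupp D) (Nlong D) (fun n => conj (a₂ n))
                  (fun n => conj (longPsiData χ b g f n))))‖
            ≤ ε * A * frakP D := by
  intro δ hδ B ε hε
  obtain ⟨D₀, hD₀⟩ := h δ hδ B ε hε
  refine ⟨D₀, fun D _ χ hD hq hp hA A hApos b g g' f f' a₂ θg θf hsg hsf hθ hg1 hf1 hb hb0 ha₂ ha₂0 => ?_⟩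
  have hb'1 : ∀ n, ‖(A : ℂ)⁻¹ * b n‖ ≤ B * ((Nat.divisors n).card : ℝ) ^ 2 := by
    intro n
    rw [norm_mul, norm_inv, Complex.norm_real, Real.norm_eq_abs, abs_of_pos hApos, inv_mul_le_iff₀ hApos]
    calc ‖b n‖ ≤ A * B * ((Nat.divisors n).card : ℝ) ^ 2 := hb n
      _ = A * (B * ((Nat.divisors n).card : ℝ) ^ 2) := by ring
  have hb'0 : ∀ n : ℕ, D ^ 5 < n → (A : ℂ)⁻¹ * b n = 0 := fun n hn => by rw [hb0 n hn, mul_zero]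
  have key := hD₀ D χ hD hq hp hA (fun n => (A : ℂ)⁻¹ * b n) g g' f f' a₂ θg θf hsg hsf hθ hg1 hf1 hb'1 hb'0
    ha₂ ha₂0
  rw [conj_longPsiData_real_inv_mul_fun, Theta1Ext_const_mul_right, longPsiData_const_mul_fun',
    lhs81Ext_const_mul_left, Theta1Ext_const_mul_left', map_mul, map_inv₀, Complex.conj_ofReal, ← mul_add,
    ← mul_sub, norm_mul, norm_inv, Complex.norm_real, Real.norm_eq_abs, abs_of_pos hApos] at key
  have hmul := mul_le_mul_of_nonneg_left key hApos.le
  rw [← mul_assoc, mul_inv_cancel₀ hApos.ne', one_mul] at hmul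
  calc _ ≤ A * (ε * frakP D) := hmul
    _ = ε * A * frakP D := by ring

/-- P2 carries EXACTLY amplitude-linear information. [cite: Zhang2022LandauSiegel, §8 Lemma 8.1 (8.5)] -/
theorem lemma81LongPsi_iff_amp (c' : ℝ) :
    Lemma81LongPsi c' ↔
    ∀ δ : ℝ, 0 < δ → ∀ B : ℝ, ∀ ε : ℝ, 0 < ε → ForAllLarge fun D _ χ => AssumptionA D χ →
      ∀ (A : ℝ), 0 < A → ∀ (b : ℕ → ℂ) (g g' f f' : ℝ → ℂ) (a₂ : ℕ → ℂ) (θg θf : ℝ),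
        ShortPiece θg g g' → ShortPiece θf f f' → θg + θf ≤ 2 - δ →
        (∀ x ∈ Set.Icc (0:ℝ) 1, ‖g x‖ ≤ 1) → (∀ x ∈ Set.Icc (0:ℝ) 1, ‖f x‖ ≤ 1) →
        (∀ n, ‖b n‖ ≤ A * B * ((Nat.divisors n).card : ℝ) ^ 2) → (∀ n : ℕ, D ^ 5 < n → b n = 0) →
        (∀ n, ‖a₂ n‖ ≤ B) → (∀ n : ℕ, D ^ 4 ≤ n → a₂ n = 0) →
          ‖lhs81Ext c' χ (Nlong D) (Nsupp D) (longPsiData χ b g f) a₂ -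
              (Theta1Ext c' χ (Nlong D) (Nsupp D) (longPsiData χ b g f) a₂ +
                conj (Theta1Ext c' χ (Nsupp D) (Nlong D) (fun n => conj (a₂ n))
                  (fun n => conj (longPsiData χ b g f n))))‖
            ≤ ε * A * frakP D := by
  refine ⟨lemma81LongPsi_amp, fun h δ hδ B ε hε => ?_⟩
  obtain ⟨D₀, hD₀⟩ := h δ hδ B ε hε
  refine ⟨D₀, fun D _ χ hD hq hp hA b g g' f f' a₂ θg θf hsg hsf hθ hg1 hf1 hb hb0 ha₂ ha₂0 => ?_⟩
  have := hD₀ D χ hD hq hp hA 1 one_pos b g g' f f' a₂ θg θf hsg hsf hθ hg1 hf1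
    (fun n => by rw [one_mul]; exact hb n) hb0 ha₂ ha₂0
  simpa only [mul_one] using this

end Summit.Parity.GeneralizedHardyLittlewood.Theorems.LongPairsGradedTables.Negative

end
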